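import Literature.NumberTheory.Transcendental.ZudilinPhi
import HarnessLib

/-!
# ζ(5) search — `DigitCert`: the PARAMETRIC strip checker for floor ("digit") functions (cell `pub-zeta5`, fam-denom 59)

HONEST FRAMING: systematic search; no irrationality claim unless certified.

OUR infrastructure (Summit side; R-D0 item (E) 59 of the lead's 2026-08-21 ruling: ONE checker for every cell table of
the cell — the record ray's Φ/(8.11) brick tables, the two-tale rungs' digit tables, the census/atlas cell ladders).
Zudilin's certificate scheme [Zudilin2004, §8 pp. 270–271] (`Literature…ZudilinPhi.PhiCert`, which is hard-wired to
the 35 terms of `φ₀`) made parametric in the TERM LIST and generalised in two ways: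

* a term is `coef · ⌊c_y·y + c_x·x⌋` with integers `coef, c_y, c_x` (`Term`; the kinds `⌊y − a x⌋`, `⌊a x − y⌋`,
  `⌊a x⌋`, `⌊2y − a x⌋` are `(c_y, c_x) = (1, −a), (−1, a), (0, a), (2, −a)`);
* a dividing line is `y = (s·x + t)/d` with a positive integer denominator `d` (`Line`).

`Cell.check ts C` certifies, by exact integer arithmetic on the strips of `C` between consecutive dividing lines, that
`c ≤ Σ_{T ∈ ts} T(x, y)` for all rational `a₀/b₀ < x < a₁/b₁` and `0 ≤ y < 1` (`Cell.check_sound`): on a strip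
`lo(x) ≤ y < hi(x)` each `c_y·y + c_x·x` is squeezed between the affine functions `c_y·lo(x) + c_x·x` and
`c_y·hi(x) + c_x·x`, which are extremal at the two `x`-endpoints; floors are monotone (`Term.lb_le`).  Integer shifts:
`evalTerms_add_int_y/x`.  The elementary `fl/flm1/affine` lemmas are imported from `PhiCert`, not re-proved.
Pure bookkeeping; nothing here bears on irrationality.  0 sorry.
-/

namespace Summit.KontsevichZagierPeriods.Zeta5Search

namespace Denom.DigitCert

open Literature.NumberTheory.Transcendental.Zudilin2004.PhiCert (fl flm1 fl_le_floor floor_le_fl floor_le_flm1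
  min_fl_le_floor floor_le_max_flm1 affine_mem affine_lt_max sum_map_le_sum_map)

/-! ### Terms, lines, cells -/

/-- A floor term `coef · ⌊c_y·y + c_x·x⌋`. -/
structure Term where
  /-- coefficient -/
  coef : ℤ
  /-- the multiplier of `y` inside the floor -/
  cy : ℤ
  /-- the multiplier of `x` inside the floor -/
  cx : ℤ
  deriving DecidableEq

/-- The value `coef · ⌊c_y·y + c_x·x⌋` of a term at `(x, y)`. -/
def Term.eval (T : Term) (x y : ℚ) : ℤ := T.coef * ⌊(T.cy : ℚ) * y + T.cx * x⌋

/-- The floor function `Σ_{T ∈ ts} T(x, y)` of a term list. -/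
def evalTerms (ts : List Term) (x y : ℚ) : ℤ := (ts.map fun T => T.eval x y).sum

/-- A dividing line `y = (s·x + t)/d`. -/
structure Line where
  /-- numerator slope -/
  s : ℤ
  /-- numerator offset -/
  t : ℤ
  /-- denominator (positive in a valid certificate) -/
  d : ℕ
  deriving DecidableEq

/-- The ordinate `(s x + t)/d` of the line at `x`. -/
def Line.eval (L : Line) (x : ℚ) : ℚ := ((L.s : ℚ) * x + L.t) / L.d

/-- The numerator of `c_y·L(a/b) + c_x·(a/b)` over the denominator `b·d`. -/
def Line.gnum (L : Line) (cy cx a : ℤ) (b : ℕ) : ℤ := cy * (L.s * a + L.t * b) + cx * L.d * a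

/-- `d` times the slope of `x ↦ c_y·L(x) + c_x·x` (zero iff that function is constant). -/
def Line.gslope (L : Line) (cy cx : ℤ) : ℤ := cy * L.s + cx * L.d

/-- A cell of a certificate: the open interval `(a₀/b₀, a₁/b₁)`, the claimed bound `c`, and the dividing lines
between `y = 0` and `y = 1`, bottom to top. -/
structure Cell where
  /-- numerator of the left endpoint -/
  a0 : ℤ
  /-- denominator of the left endpoint -/
  b0 : ℕ
  /-- numerator of the right endpoint -/
  a1 : ℤ
  /-- denominator of the right endpoint -/
  b1 : ℕ
  /-- the claimed lower bound on the cell -/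
  c : ℤ
  /-- the dividing lines, bottom to top -/
  lines : List Line
  deriving DecidableEq

/-! ### The checker -/

/-- Lower bound for a term on the region `a₀/b₀ < x < a₁/b₁`, `lo(x) ≤ y < hi(x)`, from the two `x`-endpoints. -/
def Term.lb (T : Term) (a0 : ℤ) (b0 : ℕ) (a1 : ℤ) (b1 : ℕ) (lo hi : Line) : ℤ :=
  if 0 ≤ T.coef then
    if 0 ≤ T.cy then
      T.coef * min (fl (lo.gnum T.cy T.cx a0 b0) (b0 * lo.d)) (fl (lo.gnum T.cy T.cx a1 b1) (b1 * lo.d))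
    else
      T.coef * min (fl (hi.gnum T.cy T.cx a0 b0) (b0 * hi.d)) (fl (hi.gnum T.cy T.cx a1 b1) (b1 * hi.d))
  else
    if 0 < T.cy then
      T.coef * max (flm1 (hi.gnum T.cy T.cx a0 b0) (b0 * hi.d)) (flm1 (hi.gnum T.cy T.cx a1 b1) (b1 * hi.d))
    else if lo.gslope T.cy T.cx = 0 then
      T.coef * fl (lo.gnum T.cy T.cx a0 b0) (b0 * lo.d)
    else
      T.coef * max (flm1 (lo.gnum T.cy T.cx a0 b0) (b0 * lo.d)) (flm1 (lo.gnum T.cy T.cx a1 b1) (b1 * lo.d))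

/-- The certified lower bound for `Σ T` on a strip. -/
def stripLB (ts : List Term) (a0 : ℤ) (b0 : ℕ) (a1 : ℤ) (b1 : ℕ) (lo hi : Line) : ℤ :=
  (ts.map fun T => T.lb a0 b0 a1 b1 lo hi).sum

/-- Check the strips of a cell from the line `lo` upwards (the last strip ends at `y = 1`). -/
def Cell.go (ts : List Term) (C : Cell) : Line → List Line → Bool
  | l₁, [] => decide (C.c ≤ stripLB ts C.a0 C.b0 C.a1 C.b1 l₁ ⟨0, 1, 1⟩)
  | l₁, l₂ :: rest => decide (C.c ≤ stripLB ts C.a0 C.b0 C.a1 C.b1 l₁ l₂) && Cell.go ts C l₂ rest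

/-- **The cell checker** for the term list `ts`: positive denominators everywhere and every strip certified. -/
def Cell.check (ts : List Term) (C : Cell) : Bool :=
  decide (0 < C.b0) && decide (0 < C.b1) && C.lines.all (fun L => decide (0 < L.d)) && Cell.go ts C ⟨0, 0, 1⟩ C.lines

/-! ### Soundness -/

/-- The value of `c_y·L + c_x·id` at `a/b` is `gnum/(b·d)`. -/
theorem Line.geval_eq (L : Line) (cy cx a : ℤ) {b : ℕ} (hb : 0 < b) (hd : 0 < L.d) :
    (cy : ℚ) * L.eval ((a : ℚ) / b) + cx * ((a : ℚ) / b) = (L.gnum cy cx a b : ℚ) / ((b * L.d : ℕ) : ℚ) := by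
  have hb' : (b : ℚ) ≠ 0 := by positivity
  have hd' : (L.d : ℚ) ≠ 0 := by positivity
  unfold Line.eval Line.gnum
  push_cast
  field_simp

/-- `c_y·L + c_x·id` is the affine function with slope `gslope/d` and offset `c_y·t/d`. -/
theorem Line.geval_affine (L : Line) (cy cx : ℤ) (hd : 0 < L.d) (z : ℚ) :
    ((L.gslope cy cx : ℤ) : ℚ) / L.d * z + (cy : ℚ) * L.t / L.d = (cy : ℚ) * L.eval z + cx * z := by
  have hd' : (L.d : ℚ) ≠ 0 := by positivity
  unfold Line.eval Line.gslope
  push_cast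
  field_simp
  ring

/-- **Soundness of the term bound.** -/
theorem Term.lb_le (T : Term) {a0 a1 : ℤ} {b0 b1 : ℕ} (hb0 : 0 < b0) (hb1 : 0 < b1) {lo hi : Line}
    (hdlo : 0 < lo.d) (hdhi : 0 < hi.d) {x y : ℚ} (hx0 : (a0 : ℚ) / b0 < x) (hx1 : x < (a1 : ℚ) / b1)
    (hlo : lo.eval x ≤ y) (hhi : y < hi.eval x) :
    T.lb a0 b0 a1 b1 lo hi ≤ T.eval x y := by
  rcases T with ⟨coef, cy, cx⟩
  -- the two squeezing affine functions at the endpoints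
  have Hlo := affine_mem (α := ((lo.gslope cy cx : ℤ) : ℚ) / lo.d) (β := (cy : ℚ) * lo.t / lo.d) hx0 hx1
  have Hhi := affine_mem (α := ((hi.gslope cy cx : ℤ) : ℚ) / hi.d) (β := (cy : ℚ) * hi.t / hi.d) hx0 hx1
  simp only [lo.geval_affine cy cx hdlo, hi.geval_affine cy cx hdhi, lo.geval_eq cy cx a0 hb0 hdlo,
    lo.geval_eq cy cx a1 hb1 hdlo, hi.geval_eq cy cx a0 hb0 hdhi, hi.geval_eq cy cx a1 hb1 hdhi] at Hlo Hhi
  have hb0lo : 0 < b0 * lo.d := Nat.mul_pos hb0 hdlo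
  have hb1lo : 0 < b1 * lo.d := Nat.mul_pos hb1 hdlo
  have hb0hi : 0 < b0 * hi.d := Nat.mul_pos hb0 hdhi
  have hb1hi : 0 < b1 * hi.d := Nat.mul_pos hb1 hdhi
  unfold Term.lb Term.eval
  simp only
  split_ifs with hc hcy hcy' hs
  · -- `coef ≥ 0`, `c_y ≥ 0`: `c_y y + c_x x ≥ c_y lo(x) + c_x x ≥ min`
    refine mul_le_mul_of_nonneg_left (min_fl_le_floor (Hlo.1.trans ?_)) hc
    have : (cy : ℚ) * lo.eval x ≤ cy * y := mul_le_mul_of_nonneg_left hlo (by exact_mod_cast hcy)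
    linarith
  · -- `coef ≥ 0`, `c_y < 0`: `c_y y + c_x x ≥ c_y hi(x) + c_x x ≥ min`
    refine mul_le_mul_of_nonneg_left (min_fl_le_floor (Hhi.1.trans ?_)) hc
    have : (cy : ℚ) * hi.eval x ≤ cy * y :=
      mul_le_mul_of_nonpos_left hhi.le (by exact_mod_cast (not_le.1 hcy).le)
    linarith
  · -- `coef < 0`, `c_y > 0`: `c_y y + c_x x < c_y hi(x) + c_x x ≤ max` (strict)
    refine mul_le_mul_of_nonpos_left (floor_le_max_flm1 hb0hi hb1hi (lt_of_lt_of_le ?_ Hhi.2)) (not_le.1 hc).le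
    have : (cy : ℚ) * y < cy * hi.eval x := mul_lt_mul_of_pos_left hhi (by exact_mod_cast hcy')
    linarith
  · -- `coef < 0`, `c_y ≤ 0`, `c_y lo + c_x id` constant: `c_y y + c_x x ≤ c_y lo(x) + c_x x = value at a₀/b₀`
    refine mul_le_mul_of_nonpos_left (floor_le_fl ?_) (not_le.1 hc).le
    have h1 : (cy : ℚ) * y ≤ cy * lo.eval x := mul_le_mul_of_nonpos_left hlo (by exact_mod_cast not_lt.1 hcy')
    have e1 := lo.geval_affine cy cx hdlo x
    have e0 := lo.geval_affine cy cx hdlo ((a0 : ℚ) / b0)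
    rw [lo.geval_eq cy cx a0 hb0 hdlo] at e0
    rw [hs] at e1 e0
    simp only [Int.cast_zero, zero_div, zero_mul, zero_add] at e1 e0
    have : (cy : ℚ) * lo.eval x + cx * x = (lo.gnum cy cx a0 b0 : ℚ) / ((b0 * lo.d : ℕ) : ℚ) := e1.symm.trans e0
    linarith
  · -- `coef < 0`, `c_y ≤ 0`, non-constant: `c_y y + c_x x ≤ c_y lo(x) + c_x x < max` (strict on the open interval)
    refine mul_le_mul_of_nonpos_left (floor_le_max_flm1 hb0lo hb1lo ?_) (not_le.1 hc).le
    have h1 : (cy : ℚ) * y ≤ cy * lo.eval x := mul_le_mul_of_nonpos_left hlo (by exact_mod_cast not_lt.1 hcy')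
    have hne : ((lo.gslope cy cx : ℤ) : ℚ) / lo.d ≠ 0 := by
      have : ((lo.gslope cy cx : ℤ) : ℚ) ≠ 0 := by exact_mod_cast hs
      positivity
    have hlt := affine_lt_max (β := (cy : ℚ) * lo.t / lo.d) hne hx0 hx1
    simp only [lo.geval_affine cy cx hdlo, lo.geval_eq cy cx a0 hb0 hdlo, lo.geval_eq cy cx a1 hb1 hdlo] at hlt
    linarith
/-- **Soundness of the strip bound.** -/
theorem stripLB_le (ts : List Term) {a0 a1 : ℤ} {b0 b1 : ℕ} (hb0 : 0 < b0) (hb1 : 0 < b1) {lo hi : Line}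
    (hdlo : 0 < lo.d) (hdhi : 0 < hi.d) {x y : ℚ} (hx0 : (a0 : ℚ) / b0 < x) (hx1 : x < (a1 : ℚ) / b1)
    (hlo : lo.eval x ≤ y) (hhi : y < hi.eval x) :
    stripLB ts a0 b0 a1 b1 lo hi ≤ evalTerms ts x y := by
  unfold stripLB evalTerms
  exact sum_map_le_sum_map ts fun T _ => T.lb_le hb0 hb1 hdlo hdhi hx0 hx1 hlo hhi

/-- Soundness of the strip recursion. -/
theorem Cell.go_sound (ts : List Term) (C : Cell) (hb0 : 0 < C.b0) (hb1 : 0 < C.b1) {x y : ℚ}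
    (hx0 : (C.a0 : ℚ) / C.b0 < x) (hx1 : x < (C.a1 : ℚ) / C.b1) (hy1 : y < 1) :
    ∀ (rest : List Line) (lo : Line), (∀ L ∈ rest, 0 < L.d) → 0 < lo.d → lo.eval x ≤ y →
      Cell.go ts C lo rest = true → C.c ≤ evalTerms ts x y := by
  intro rest
  induction rest with
  | nil =>
    intro lo _ hdlo hlo h
    simp only [Cell.go, decide_eq_true_eq] at h
    exact h.trans (stripLB_le ts hb0 hb1 hdlo Nat.one_pos hx0 hx1 hlo (by simpa [Line.eval] using hy1))
  | cons hi rest ih =>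
    intro lo hrest hdlo hlo h
    simp only [Cell.go, Bool.and_eq_true, decide_eq_true_eq] at h
    have hdhi : 0 < hi.d := hrest hi (by simp)
    by_cases hy : y < hi.eval x
    · exact h.1.trans (stripLB_le ts hb0 hb1 hdlo hdhi hx0 hx1 hlo hy)
    · exact ih hi (fun L hL => hrest L (by simp [hL])) hdhi (not_lt.1 hy) h.2

/-- **Soundness of the cell checker**: `Cell.check ts C = true` ⟹ `c ≤ Σ_{T ∈ ts} T(x, y)` for all
`a₀/b₀ < x < a₁/b₁` and `0 ≤ y < 1`. -/
theorem Cell.check_sound {ts : List Term} {C : Cell} (h : Cell.check ts C = true) {x y : ℚ}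
    (hx0 : (C.a0 : ℚ) / C.b0 < x) (hx1 : x < (C.a1 : ℚ) / C.b1) (hy0 : 0 ≤ y) (hy1 : y < 1) :
    C.c ≤ evalTerms ts x y := by
  simp only [Cell.check, Bool.and_eq_true, decide_eq_true_eq, List.all_eq_true] at h
  exact Cell.go_sound ts C h.1.1.1 h.1.1.2 hx0 hx1 hy1 C.lines ⟨0, 0, 1⟩ (fun L hL => h.1.2 L hL) Nat.one_pos
    (by simpa [Line.eval] using hy0) h.2

/-- Soundness for a cell of a checked table. -/
theorem check_sound_of_mem {ts : List Term} {cells : List Cell} (h : cells.all (Cell.check ts) = true) {C : Cell}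
    (hC : C ∈ cells) {x y : ℚ} (hx0 : (C.a0 : ℚ) / C.b0 < x) (hx1 : x < (C.a1 : ℚ) / C.b1) (hy0 : 0 ≤ y)
    (hy1 : y < 1) : C.c ≤ evalTerms ts x y :=
  Cell.check_sound (List.all_eq_true.1 h C hC) hx0 hx1 hy0 hy1

/-! ### Integer shifts -/

/-- `Σ T(x, y + m) = Σ T(x, y) + m · Σ coef·c_y`. -/
theorem evalTerms_add_int_y (ts : List Term) (x y : ℚ) (m : ℤ) :
    evalTerms ts x (y + m) = evalTerms ts x y + m * (ts.map fun T => T.coef * T.cy).sum := by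
  induction ts with
  | nil => simp [evalTerms]
  | cons T ts ih =>
    simp only [evalTerms, List.map_cons, List.sum_cons] at ih ⊢
    rw [ih, Term.eval, Term.eval, show (T.cy : ℚ) * (y + m) + T.cx * x = (T.cy * y + T.cx * x) + ((T.cy * m : ℤ) : ℚ)
      by push_cast; ring, Int.floor_add_intCast]
    ring

/-- `Σ T(x + m, y) = Σ T(x, y) + m · Σ coef·c_x`. -/
theorem evalTerms_add_int_x (ts : List Term) (x y : ℚ) (m : ℤ) :
    evalTerms ts (x + m) y = evalTerms ts x y + m * (ts.map fun T => T.coef * T.cx).sum := by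
  induction ts with
  | nil => simp [evalTerms]
  | cons T ts ih =>
    simp only [evalTerms, List.map_cons, List.sum_cons] at ih ⊢
    rw [ih, Term.eval, Term.eval, show (T.cy : ℚ) * y + T.cx * (x + m) = (T.cy * y + T.cx * x) + ((T.cx * m : ℤ) : ℚ)
      by push_cast; ring, Int.floor_add_intCast]
    ring

end Denom.DigitCert

end Summit.KontsevichZagierPeriods.Zeta5Search
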